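import Summits.CriticalPhenomena.PercolationContinuityZ3.Theorems.PercNearOneGluingNoHeavyLowerTailSahiCTCRtThreeWindowFourDefs
import HarnessLib

/-!
# `NoHeavyLowerTail` (crux stmt-CriticalPhenomena-4575), P3 lane: the FIFTEEN WEIGHT POLYNOMIALS of the four-point window

Support file (seat `prim-l12-p3`, gen 51; `--supports stmt-CriticalPhenomena-4575`).  Memo
`run/shared/lean/prim/prim-l12/FROM-prim-l12-p3-g51-ROW0-ALL-K-LEAN.md`.

With `Dfac j = 2k(k−1)(k−2)(k−3)(k−4)(k−5)` at `k = j + 10` (definitions in `…RtThreeWindowFourDefs`):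
* (private) `cast_choose_three/four_eq`, `cast_choose_two/three/four_add` : `C(m,3), C(m,4)` in `ℚ` in subtraction-free form (from Mathlib's `Nat.cast_choose_two`);
* `Wloc_expand` : the local `J`-weight at `k = j + 10` with its case distinctions resolved;
* `poly_J10 … poly_J43`, `poly_P0 … poly_P4` (`poly_J`, `poly_P`) : `Dfac j · Wloc (j+10) n s = Σ_{i<8} SJ n s i · j^i` for the ten `J`-classes and
  `Dfac j / C(j+10−m, 4−m) = Σ_{i<8} SP m i · j^i` for the five pair classes (`field_simp; ring`);
* `loc_poly` : `Dfac j · (Σ_c Wloc·momJ + Σ_m momP/C) = Σ_{i<8} (Σ_c SJ c i · momJ c + Σ_m SP m i · momP m) · j^i`.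
No new definitions; nothing is asserted about the crux.
-/

noncomputable section

namespace Summit.CriticalPhenomena.PercolationContinuityZ3.Theorems.SahiCTCForms

open Finset

/-! ## Part POLY: the fifteen weight polynomials -/

namespace RtThreeFin4

/-- `C(m,3)` in `ℚ`. [folklore] -/
private theorem cast_choose_three_eq (m : ℕ) : ((m.choose 3 : ℕ) : ℚ) = (m : ℚ) * ((m : ℚ) - 1) * ((m : ℚ) - 2) / 6 := by
  induction m with
  | zero => simp
  | succ m ih => rw [Nat.choose_succ_succ, Nat.cast_add, ih, Nat.cast_choose_two]; push_cast; ring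

/-- `C(m,4)` in `ℚ`. [folklore] -/
private theorem cast_choose_four_eq (m : ℕ) :
    ((m.choose 4 : ℕ) : ℚ) = (m : ℚ) * ((m : ℚ) - 1) * ((m : ℚ) - 2) * ((m : ℚ) - 3) / 24 := by
  induction m with
  | zero => simp
  | succ m ih => rw [Nat.choose_succ_succ, Nat.cast_add, ih, cast_choose_three_eq]; push_cast; ring

/-- `C(m+2,2)` in `ℚ`, additive form. [folklore] -/
private theorem cast_choose_two_add (m : ℕ) : (((m + 2).choose 2 : ℕ) : ℚ) = ((m : ℚ) + 2) * ((m : ℚ) + 1) / 2 := by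
  rw [Nat.cast_choose_two]; push_cast; ring

/-- `C(m+3,3)` in `ℚ`, additive form. [folklore] -/
private theorem cast_choose_three_add (m : ℕ) : (((m + 3).choose 3 : ℕ) : ℚ) = ((m : ℚ) + 3) * ((m : ℚ) + 2) * ((m : ℚ) + 1) / 6 := by
  rw [cast_choose_three_eq]; push_cast; ring

/-- `C(m+4,4)` in `ℚ`, additive form. [folklore] -/
private theorem cast_choose_four_add (m : ℕ) :
    (((m + 4).choose 4 : ℕ) : ℚ) = ((m : ℚ) + 4) * ((m : ℚ) + 3) * ((m : ℚ) + 2) * ((m : ℚ) + 1) / 24 := by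
  rw [cast_choose_four_eq]; push_cast; ring

/-- The local weight at `k = j + 10` with the case distinctions resolved (`n ≤ 4`, `s ≤ 3`). [this work] -/
theorem Wloc_expand (j n s : ℕ) (hn : n ≤ 4) (hs : s ≤ 3) :
    Wloc (j + 10) n s =
      ((((j + 10 - n).choose 0 : ℕ) : ℚ) * ((((j + 10 : ℕ) : ℚ)) * ((((j + 9).choose s : ℕ) : ℚ)))⁻¹
        + (((j + 10 - n).choose 1 : ℕ) : ℚ) * ((((j + 9 : ℕ) : ℚ)) * ((((j + 8).choose s : ℕ) : ℚ)))⁻¹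
        + (((j + 10 - n).choose 2 : ℕ) : ℚ) * ((((j + 8 : ℕ) : ℚ)) * ((((j + 7).choose s : ℕ) : ℚ)))⁻¹)
      / (((j + 10 - n).choose (4 - n) : ℕ) : ℚ) := by
  have e1 : j + 10 - 1 = j + 9 := by omega
  have e2 : j + 10 - 2 = j + 8 := by omega
  have e3 : j + 9 - 1 = j + 8 := by omega
  have e4 : j + 8 - 1 = j + 7 := by omega
  unfold Wloc
  rw [if_neg (by omega)]
  simp only [sum_range_succ, sum_range_zero, zero_add, Nat.sub_zero, e1, e2, e3, e4]
  rw [if_pos (by omega), if_pos (by omega), if_pos (by omega)]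

/-- `J`-class `(1,0)`: `Wloc·Dfac` at `k = j + 10` is the polynomial with coefficients `SJ 1 0`. [this work] -/
theorem poly_J10 (j : ℕ) : Wloc (j + 10) 1 0 * Dfac j = ∑ i ∈ range 8, ((SJ 1 0 i : ℤ) : ℚ) * (j : ℚ) ^ i := by
  rw [Wloc_expand j 1 0 (by norm_num) (by norm_num), show j + 10 - 1 = j + 9 by omega]
  simp [cast_choose_two_add, cast_choose_three_add, sum_range_succ, SJ, SJl, Dfac]
  field_simp
  ring

/-- `J`-class `(2,0)`: `Wloc·Dfac` at `k = j + 10` is the polynomial with coefficients `SJ 2 0`. [this work] -/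
theorem poly_J20 (j : ℕ) : Wloc (j + 10) 2 0 * Dfac j = ∑ i ∈ range 8, ((SJ 2 0 i : ℤ) : ℚ) * (j : ℚ) ^ i := by
  rw [Wloc_expand j 2 0 (by norm_num) (by norm_num), show j + 10 - 2 = j + 8 by omega]
  simp [cast_choose_two_add, sum_range_succ, SJ, SJl, Dfac]
  field_simp
  ring

/-- `J`-class `(2,1)`: `Wloc·Dfac` at `k = j + 10` is the polynomial with coefficients `SJ 2 1`. [this work] -/
theorem poly_J21 (j : ℕ) : Wloc (j + 10) 2 1 * Dfac j = ∑ i ∈ range 8, ((SJ 2 1 i : ℤ) : ℚ) * (j : ℚ) ^ i := by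
  rw [Wloc_expand j 2 1 (by norm_num) (by norm_num), show j + 10 - 2 = j + 8 by omega]
  simp [cast_choose_two_add, sum_range_succ, SJ, SJl, Dfac]
  field_simp
  ring

/-- `J`-class `(3,0)`: `Wloc·Dfac` at `k = j + 10` is the polynomial with coefficients `SJ 3 0`. [this work] -/
theorem poly_J30 (j : ℕ) : Wloc (j + 10) 3 0 * Dfac j = ∑ i ∈ range 8, ((SJ 3 0 i : ℤ) : ℚ) * (j : ℚ) ^ i := by
  rw [Wloc_expand j 3 0 (by norm_num) (by norm_num), show j + 10 - 3 = j + 7 by omega]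
  simp [cast_choose_two_add, sum_range_succ, SJ, SJl, Dfac]
  field_simp
  ring

/-- `J`-class `(3,1)`: `Wloc·Dfac` at `k = j + 10` is the polynomial with coefficients `SJ 3 1`. [this work] -/
theorem poly_J31 (j : ℕ) : Wloc (j + 10) 3 1 * Dfac j = ∑ i ∈ range 8, ((SJ 3 1 i : ℤ) : ℚ) * (j : ℚ) ^ i := by
  rw [Wloc_expand j 3 1 (by norm_num) (by norm_num), show j + 10 - 3 = j + 7 by omega]
  simp [cast_choose_two_add, sum_range_succ, SJ, SJl, Dfac]
  field_simp
  ring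

/-- `J`-class `(3,2)`: `Wloc·Dfac` at `k = j + 10` is the polynomial with coefficients `SJ 3 2`. [this work] -/
theorem poly_J32 (j : ℕ) : Wloc (j + 10) 3 2 * Dfac j = ∑ i ∈ range 8, ((SJ 3 2 i : ℤ) : ℚ) * (j : ℚ) ^ i := by
  rw [Wloc_expand j 3 2 (by norm_num) (by norm_num), show j + 10 - 3 = j + 7 by omega]
  simp [cast_choose_two_add, sum_range_succ, SJ, SJl, Dfac]
  field_simp
  ring

/-- `J`-class `(4,0)`: `Wloc·Dfac` at `k = j + 10` is the polynomial with coefficients `SJ 4 0`. [this work] -/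
theorem poly_J40 (j : ℕ) : Wloc (j + 10) 4 0 * Dfac j = ∑ i ∈ range 8, ((SJ 4 0 i : ℤ) : ℚ) * (j : ℚ) ^ i := by
  rw [Wloc_expand j 4 0 (by norm_num) (by norm_num), show j + 10 - 4 = j + 6 by omega]
  simp [cast_choose_two_add, sum_range_succ, SJ, SJl, Dfac]
  field_simp
  ring

/-- `J`-class `(4,1)`: `Wloc·Dfac` at `k = j + 10` is the polynomial with coefficients `SJ 4 1`. [this work] -/
theorem poly_J41 (j : ℕ) : Wloc (j + 10) 4 1 * Dfac j = ∑ i ∈ range 8, ((SJ 4 1 i : ℤ) : ℚ) * (j : ℚ) ^ i := by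
  rw [Wloc_expand j 4 1 (by norm_num) (by norm_num), show j + 10 - 4 = j + 6 by omega]
  simp [cast_choose_two_add, sum_range_succ, SJ, SJl, Dfac]
  field_simp
  ring

/-- `J`-class `(4,2)`: `Wloc·Dfac` at `k = j + 10` is the polynomial with coefficients `SJ 4 2`. [this work] -/
theorem poly_J42 (j : ℕ) : Wloc (j + 10) 4 2 * Dfac j = ∑ i ∈ range 8, ((SJ 4 2 i : ℤ) : ℚ) * (j : ℚ) ^ i := by
  rw [Wloc_expand j 4 2 (by norm_num) (by norm_num), show j + 10 - 4 = j + 6 by omega]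
  simp [cast_choose_two_add, sum_range_succ, SJ, SJl, Dfac]
  field_simp
  ring

/-- `J`-class `(4,3)`: `Wloc·Dfac` at `k = j + 10` is the polynomial with coefficients `SJ 4 3`. [this work] -/
theorem poly_J43 (j : ℕ) : Wloc (j + 10) 4 3 * Dfac j = ∑ i ∈ range 8, ((SJ 4 3 i : ℤ) : ℚ) * (j : ℚ) ^ i := by
  rw [Wloc_expand j 4 3 (by norm_num) (by norm_num), show j + 10 - 4 = j + 6 by omega]
  simp [cast_choose_two_add, cast_choose_three_add, sum_range_succ, SJ, SJl, Dfac]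
  field_simp
  ring

/-- Pair class `m = 0`: `Dfac / C(k−0, 4)` at `k = j + 10` is the polynomial with coefficients `SP 0`. [this work] -/
theorem poly_P0 (j : ℕ) : (1 / ((((j + 10 - 0).choose (4 - 0) : ℕ) : ℚ))) * Dfac j = ∑ i ∈ range 8, ((SP 0 i : ℤ) : ℚ) * (j : ℚ) ^ i := by
  rw [show j + 10 - 0 = j + 10 by omega]
  simp [cast_choose_four_add, sum_range_succ, SP, SPl, Dfac]
  field_simp
  ring

/-- Pair class `m = 1`: `Dfac / C(k−1, 3)` at `k = j + 10` is the polynomial with coefficients `SP 1`. [this work] -/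
theorem poly_P1 (j : ℕ) : (1 / ((((j + 10 - 1).choose (4 - 1) : ℕ) : ℚ))) * Dfac j = ∑ i ∈ range 8, ((SP 1 i : ℤ) : ℚ) * (j : ℚ) ^ i := by
  rw [show j + 10 - 1 = j + 9 by omega]
  simp [cast_choose_three_add, sum_range_succ, SP, SPl, Dfac]
  field_simp
  ring

/-- Pair class `m = 2`: `Dfac / C(k−2, 2)` at `k = j + 10` is the polynomial with coefficients `SP 2`. [this work] -/
theorem poly_P2 (j : ℕ) : (1 / ((((j + 10 - 2).choose (4 - 2) : ℕ) : ℚ))) * Dfac j = ∑ i ∈ range 8, ((SP 2 i : ℤ) : ℚ) * (j : ℚ) ^ i := by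
  rw [show j + 10 - 2 = j + 8 by omega]
  simp [cast_choose_two_add, sum_range_succ, SP, SPl, Dfac]
  field_simp
  ring

/-- Pair class `m = 3`: `Dfac / C(k−3, 1)` at `k = j + 10` is the polynomial with coefficients `SP 3`. [this work] -/
theorem poly_P3 (j : ℕ) : (1 / ((((j + 10 - 3).choose (4 - 3) : ℕ) : ℚ))) * Dfac j = ∑ i ∈ range 8, ((SP 3 i : ℤ) : ℚ) * (j : ℚ) ^ i := by
  rw [show j + 10 - 3 = j + 7 by omega]
  simp [sum_range_succ, SP, SPl, Dfac]
  field_simp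
  ring

/-- Pair class `m = 4`: `Dfac / C(k−4, 0)` at `k = j + 10` is the polynomial with coefficients `SP 4`. [this work] -/
theorem poly_P4 (j : ℕ) : (1 / ((((j + 10 - 4).choose (4 - 4) : ℕ) : ℚ))) * Dfac j = ∑ i ∈ range 8, ((SP 4 i : ℤ) : ℚ) * (j : ℚ) ^ i := by
  rw [show j + 10 - 4 = j + 6 by omega]
  simp [sum_range_succ, SP, SPl, Dfac]
  field_simp
  ring

/-- All ten `J`-classes at once. [this work] -/
theorem poly_J (j : ℕ) : ∀ c ∈ JCLl.toFinset, Wloc (j + 10) c.1 c.2 * Dfac j = ∑ i ∈ range 8, ((SJ c.1 c.2 i : ℤ) : ℚ) * (j : ℚ) ^ i := by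
  intro c hc
  simp only [JCLl, List.toFinset_cons, List.toFinset_nil, insert_empty_eq, mem_insert, mem_singleton] at hc
  rcases hc with rfl | rfl | rfl | rfl | rfl | rfl | rfl | rfl | rfl | rfl
  exacts [poly_J10 j, poly_J20 j, poly_J21 j, poly_J30 j, poly_J31 j, poly_J32 j, poly_J40 j, poly_J41 j, poly_J42 j, poly_J43 j]

/-- All five pair classes at once. [this work] -/
theorem poly_P (j : ℕ) : ∀ m ∈ range 5, (1 / ((((j + 10 - m).choose (4 - m) : ℕ) : ℚ))) * Dfac j = ∑ i ∈ range 8, ((SP m i : ℤ) : ℚ) * (j : ℚ) ^ i := by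
  intro m hm
  have : m = 0 ∨ m = 1 ∨ m = 2 ∨ m = 3 ∨ m = 4 := by have := mem_range.1 hm; omega
  rcases this with rfl | rfl | rfl | rfl | rfl
  exacts [poly_P0 j, poly_P1 j, poly_P2 j, poly_P3 j, poly_P4 j]

/-- **THE CLEARED LOCAL QUANTITY IS A POLYNOMIAL IN `j = k − 10` WHOSE COEFFICIENTS ARE THE LINEAR FORMS `Σ SJ·momJ + Σ SP·momP`.** [this work] -/
theorem loc_poly (j : ℕ) (F G : Finset (Finset (Fin 4))) :
    Dfac j * (∑ c ∈ JCLl.toFinset, Wloc (j + 10) c.1 c.2 * momJ c.1 c.2 F G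
        + ∑ m ∈ range 5, (1 / ((((j + 10 - m).choose (4 - m) : ℕ) : ℚ))) * momP m F G) =
      ∑ i ∈ range 8, (∑ c ∈ JCLl.toFinset, ((SJ c.1 c.2 i : ℤ) : ℚ) * momJ c.1 c.2 F G
        + ∑ m ∈ range 5, ((SP m i : ℤ) : ℚ) * momP m F G) * (j : ℚ) ^ i := by
  have hJ : ∀ c ∈ JCLl.toFinset, Dfac j * (Wloc (j + 10) c.1 c.2 * momJ c.1 c.2 F G) =
      ∑ i ∈ range 8, (((SJ c.1 c.2 i : ℤ) : ℚ) * momJ c.1 c.2 F G) * (j : ℚ) ^ i := fun c hc => by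
    rw [← mul_assoc, mul_comm (Dfac j), poly_J j c hc, sum_mul]
    exact sum_congr rfl fun i _ => by ring
  have hP : ∀ m ∈ range 5, Dfac j * ((1 / ((((j + 10 - m).choose (4 - m) : ℕ) : ℚ))) * momP m F G) =
      ∑ i ∈ range 8, (((SP m i : ℤ) : ℚ) * momP m F G) * (j : ℚ) ^ i := fun m hm => by
    rw [← mul_assoc, mul_comm (Dfac j), poly_P j m hm, sum_mul]
    exact sum_congr rfl fun i _ => by ring
  rw [mul_add, mul_sum, mul_sum, sum_congr rfl hJ, sum_congr rfl hP, sum_comm, sum_comm (s := range 5), ← sum_add_distrib]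
  refine sum_congr rfl fun i _ => ?_
  rw [add_mul, sum_mul, sum_mul]


end RtThreeFin4

end Summit.CriticalPhenomena.PercolationContinuityZ3.Theorems.SahiCTCForms
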